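import Summits.SmoothPoincare4.SmoothPoincare4.Theorems.EntropyRungMargerinRailsDefs
import Summits.SmoothPoincare4.SmoothPoincare4.Theorems.EntropyRungChangGurskyYangStubMaximalFlow
import Summits.SmoothPoincare4.SmoothPoincare4.Theorems.EntropyRungChangGurskyYangStubInvariantPinching
import Summits.SmoothPoincare4.SmoothPoincare4.Theorems.EntropyRungChangGurskyYangStubLimitRound
import Summits.SmoothPoincare4.SmoothPoincare4.Theorems.EntropyRungChangGurskyYangStubRoundRecognition
import Summits.SmoothPoincare4.SmoothPoincare4.Theorems.EntropyRungChangGurskyYangStubTransfer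
import Literature.Geometry.Riemannian.RicciFlowBlowupLimit
import Literature.Geometry.Riemannian.HamiltonConvergenceCriterion
import Literature.Geometry.Riemannian.PinchingEstimatesConstraints
import Summits.SmoothPoincare4.SmoothPoincare4.Theorems.EntropyRungChangGurskyYangOfRemainingFacts
import HarnessLib

/-!
# Route EntropyRung · crux `ChangGurskyYang` · line `margerin-cone-hamilton-rails` — STUB 4 and
# Hamilton's convergence criterion, closed MODULO the blow-up limit (`ricciFlow_blowupLimit_four`)

The flow endgame of Margerin's leaf (STUB 4 `stub_pinchedFlowConvergence` of the skeleton
`Cruxes/ChangGurskyYang/Lines/margerin_cone_hamilton_rails.lean`, crux stmt-SmoothPoincare4-10834,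
`Summit.SmoothPoincare4.SmoothPoincare4.Theses.EntropyRung.ChangGurskyYang`; = Hamilton 1986, §5,
criterion 5.2 for the pinching sets `pinchingSet m c K τ`) assembled from the five LANDED stubs of the
lead's reshape r5 — `stub_maximalFlow` (p110641), `stub_invariantPinching` (p110603),
`stub_limitRound` (p110802), `stub_roundRecognition` (p110705), `stub_transfer` (p110789) — and the ONE
named fact `Literature.Geometry.Riemannian.ricciFlow_blowupLimit_four` (Topping 2006 Thm. 8.5.1: the
blow-up limit at a finite-time singularity; Hamilton 1995 compactness + Perelman 2002 no local
collapsing; `RicciFlowBlowupLimit.lean`, p110613):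

* `constantCurvature_of_pinchedFlows` — the chain: maximal flow from `g₀` (finite-time since `R ≥ m`)
  → blow up at the singular time (the fact: pointed limit `(N, h, p_∞)` of the rescaled slices with
  convergent curvature invariants) → the pinching in invariant form along the flow → the limit is
  Einstein, conformally flat, `R_h(p_∞) > 0` → Schur + Besse 1.118 + Myers + Heine–Borel: compact of
  constant curvature `k > 0` → transported to `M` by a bijective local diffeomorphism;
* `stub_pinchedFlowConvergence_of_blowupLimit` — STUB 4 VERBATIM in colon form
  `ricciFlow_blowupLimit_four → …` (registered on the crux item);
* `mem_pinchingSet_of_hamiltonSet` — Hamilton's pinching set `{R ≥ m} ∩ {|M̊|² ≤ K R^{2−τ}}` of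
  `hamilton_convergenceCriterion_four` (any `τ > 0`) sits inside `pinchingSet m c K' τ'` with
  `τ' = min τ 1 ≤ 1`, `K' = K m^{τ'−τ}`, `c = K' m^{−τ'}` (`R ≥ m` and monotonicity of `R ↦ R^z` for
  `z ≤ 0`; symmetry of `A`, `C` and `tr A = tr C` hold for every Levi-Civita connection:
  `blockA_isSymm`, `blockC_isSymm`, `trace_blockA_eq_trace_blockC`);
* `ChangGurskyYang_of_blowupLimit_of_theorem14` (+ the `WeylBudget` twin) — the CRUX closed modulo
  {blow-up limit, CGY Thm 1.4} (composing with `ChangGurskyYang_of_theorem14_of_convergenceCriterion`,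
  p96074); the companion file `…OfBlowupLimitGv.lean` composes with line `gv-continuity-path`'s
  `changGurskyYang_theorem14_four_of_gvPathFacts` (p108727) for the closure modulo {blow-up limit, GV×4};
* `hamilton_convergenceCriterion_four_of_blowupLimit` — **the bespoke fact
  `hamilton_convergenceCriterion_four` (HamiltonConvergenceCriterion.lean, used by this line's p84954 and
  by line `gv-continuity-path`'s `ChangGurskyYang_of_gvPathFacts`, p108727) FOLLOWS from
  `ricciFlow_blowupLimit_four`** — so both lines' flow stubs now rest on the standard compactness
  theorem instead of Hamilton 1982 §§10–17 / 1986 §5.2.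

No `sorry`; no new definition; the only unproved input is the hypothesis `ricciFlow_blowupLimit_four`.

References: Hamilton 1986 [Hamilton1986] §5; Margerin 1998 [Margerin1998] Part VI; Topping 2006
[Topping2006] §8.5; Morgan–Tian 2007 [MorganTian2007] Ch. 5.
-/

noncomputable section

-- every `Summit.SmoothPoincare4.SmoothPoincare4.…` name repeats the summit = sub-problem segment (D-0017 layout)
set_option linter.dupNamespace false

open Set Function Module Filter
open scoped Manifold ContDiff Matrix BigOperators Topology

namespace Summit.SmoothPoincare4.SmoothPoincare4.Theorems.MargerinRails

open Literature.Geometry.Riemannian Literature.Geometry.Riemannian.HamiltonODE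
open Literature.Geometry.Lorentzian Literature.Geometry.Lorentzian.PseudoRiemannianMetric

/-! ## The chain: pinched flows give a metric of constant positive curvature -/

/-- **A pinched Ricci flow on a closed connected 4-manifold yields a metric of constant sectional
curvature `k > 0`, given the blow-up limit** (Hamilton 1986, §5, criterion 5.2 for the sets
`pinchingSet m c K τ`, `0 < τ ≤ 1`; proof along the blow-up / round-limit endgame: `stub_maximalFlow` →
`ricciFlow_blowupLimit_four` → `stub_invariantPinching` → `stub_limitRound` → `stub_roundRecognition` →
`stub_transfer`). The cone parameter `c` is unconstrained (only the faces `R ≥ m`,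
`|𝒟|² ≤ K R^{2−τ}` are used). [cite: Hamilton1986, §5, 5.2 (p. 164)] [cite: Topping2006, §8.5, Thm. 8.5.1] -/
theorem constantCurvature_of_pinchedFlows (hbl : ricciFlow_blowupLimit_four)
    (M : Type) [TopologicalSpace M] [T2Space M] [SecondCountableTopology M]
    [ChartedSpace (EuclideanSpace ℝ (Fin 4)) M] [IsManifold (𝓡 4) ∞ M] [CompactSpace M]
    [ConnectedSpace M]
    (g₀ : PseudoRiemannianMetric (𝓡 4) ∞ (EuclideanSpace ℝ (Fin 4)) (TangentSpace (𝓡 4) : M → Type _))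
    (m c K τ : ℝ) (hg₀ : g₀.IsRiemannian) (hm : 0 < m) (hK : 0 < K) (hτ0 : 0 < τ) (hτ1 : τ ≤ 1)
    (hflows : ∀ (T : ℝ)
        (g : ℝ → PseudoRiemannianMetric (𝓡 4) ∞ (EuclideanSpace ℝ (Fin 4))
          (TangentSpace (𝓡 4) : M → Type _))
        (cov : ℝ → CovariantDerivative (𝓡 4) (EuclideanSpace ℝ (Fin 4))
          (TangentSpace (𝓡 4) : M → Type _)),
        IsRicciFlow g cov (Ico 0 T) → (∀ t ∈ Ico 0 T, (g t).IsRiemannian) → g 0 = g₀ →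
        ∀ t ∈ Ico 0 T, ∀ (x : M) (e : Fin 4 → TangentSpace (𝓡 4) x),
          (g t).IsOrthonormalFrame x e →
            ((g t).blockA (cov t) x e, (g t).blockB (cov t) x e, (g t).blockC (cov t) x e) ∈
              pinchingSet m c K τ) :
    ∃ (k : ℝ) (g' : PseudoRiemannianMetric (𝓡 4) ∞ (EuclideanSpace ℝ (Fin 4))
        (TangentSpace (𝓡 4) : M → Type _)),
      0 < k ∧ g'.IsRiemannian ∧ g'.HasConstantSectionalCurvature k := by
  -- the maximal flow from `g₀` is finite-time
  obtain ⟨T, g, cov, hmax, h0⟩ := stub_maximalFlow M g₀ m c K τ hg₀ hm hflows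
  -- blow up at the singular time
  obtain ⟨p, t, Q, ht, -, hQpos, hQ, -, -, N, _, _, _, _, _, _, h, _, hh, pinf, U, φ, hcomplete,
    hUopen, hUmono, -, hUcov, hφ, hφinj, -, hnorm, -, hR, hRm, hW, hE⟩ := hbl M g cov T hmax
  -- the pinching along the maximal flow, in invariant form
  have hpinch : ∀ s ∈ Ico 0 T, ∀ [(g s).HasLeviCivita] (x : M),
      m ≤ (g s).scalarCurvature x ∧
        (g s).weylNormSq x + 2 * (g s).tracelessRicciNormSq x ≤
          K * (g s).scalarCurvature x ^ (2 - τ) := by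
    intro s hs _ x
    exact stub_invariantPinching M (g s) (cov s) m c K τ (hmax.isRiemannian s hs)
      (hmax.isRicciFlow.isLeviCivita s hs)
      (fun y e he ↦ hflows T g cov hmax.isRicciFlow hmax.isRiemannian h0 s hs y e he) x
  -- the limit is Einstein, conformally flat, with `R_h(p_∞) > 0`
  haveI : ∀ n, (g (t n)).HasLeviCivita := fun n ↦ (g (t n)).hasLeviCivita
  obtain ⟨hWh, hRic, hpos⟩ := stub_limitRound M g cov T m K τ hm hK hτ0 hτ1 hmax.isRicciFlow
    hmax.isRiemannian hpinch t Q ht hQpos hQ N h hh pinf φ hnorm hR hRm hW hE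
  -- round recognition: `N` is compact of constant curvature `k > 0`
  obtain ⟨hcpt, k, hk, hconst⟩ := stub_roundRecognition N h hh hcomplete hWh hRic ⟨pinf, hpos⟩
  -- transfer to `M`
  haveI : Nonempty N := ⟨pinf⟩
  obtain ⟨g', hg', hconst'⟩ := stub_transfer M N h k hh hconst U φ hUopen hUmono hUcov hφ hφinj
  exact ⟨k, g', hk, hg', hconst'⟩

/-- **STUB 4 of line `margerin-cone-hamilton-rails`, VERBATIM, closed modulo the blow-up limit**
(colon form `ricciFlow_blowupLimit_four → <stub_pinchedFlowConvergence>`, registered on the crux item;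
Hamilton 1986, §5, 5.2 for Margerin's pinching sets = Margerin 1998, Part VI). The skeleton's
`stub_pinchedFlowConvergence` is `stub_pinchedFlowConvergence_of_blowupLimit h` for any
`h : ricciFlow_blowupLimit_four`. [cite: Hamilton1986, §5, 5.2 (p. 164)] [cite: Margerin1998, Part VI, pp. 53–57] -/
theorem stub_pinchedFlowConvergence_of_blowupLimit :
    ricciFlow_blowupLimit_four →
    ∀ (M : Type) [TopologicalSpace M] [T2Space M] [SecondCountableTopology M]
      [ChartedSpace (EuclideanSpace ℝ (Fin 4)) M] [IsManifold (𝓡 4) ∞ M] [CompactSpace M]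
      [ConnectedSpace M]
      (g₀ : PseudoRiemannianMetric (𝓡 4) ∞ (EuclideanSpace ℝ (Fin 4)) (TangentSpace (𝓡 4) : M → Type _))
      (m c K τ : ℝ), g₀.IsRiemannian → 0 < m → 0 < c → c < 1 / 6 → 0 < K → 0 < τ → τ ≤ 1 →
      (∀ (cov : CovariantDerivative (𝓡 4) (EuclideanSpace ℝ (Fin 4)) (TangentSpace (𝓡 4) : M → Type _)),
        g₀.IsLeviCivita cov →
        ∀ (x : M) (e : Fin 4 → TangentSpace (𝓡 4) x), g₀.IsOrthonormalFrame x e →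
          (g₀.blockA cov x e, g₀.blockB cov x e, g₀.blockC cov x e) ∈ pinchingSet m c K τ) →
      (∀ (T : ℝ)
        (g : ℝ → PseudoRiemannianMetric (𝓡 4) ∞ (EuclideanSpace ℝ (Fin 4))
          (TangentSpace (𝓡 4) : M → Type _))
        (cov : ℝ → CovariantDerivative (𝓡 4) (EuclideanSpace ℝ (Fin 4))
          (TangentSpace (𝓡 4) : M → Type _)),
        IsRicciFlow g cov (Ico 0 T) → (∀ t ∈ Ico 0 T, (g t).IsRiemannian) → g 0 = g₀ →
        ∀ t ∈ Ico 0 T, ∀ (x : M) (e : Fin 4 → TangentSpace (𝓡 4) x),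
          (g t).IsOrthonormalFrame x e →
            ((g t).blockA (cov t) x e, (g t).blockB (cov t) x e, (g t).blockC (cov t) x e) ∈
              pinchingSet m c K τ) →
      ∃ (k : ℝ) (g' : PseudoRiemannianMetric (𝓡 4) ∞ (EuclideanSpace ℝ (Fin 4))
          (TangentSpace (𝓡 4) : M → Type _)),
        0 < k ∧ g'.IsRiemannian ∧ g'.HasConstantSectionalCurvature k :=
  fun hbl M _ _ _ _ _ _ _ g₀ m c K τ hg₀ hm _ _ hK hτ0 hτ1 _ hflows ↦
    constantCurvature_of_pinchedFlows hbl M g₀ m c K τ hg₀ hm hK hτ0 hτ1 hflows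

/-! ## Hamilton's pinching set inside `pinchingSet` -/

/-- **Monotonicity of the pinching exponent**: for `0 < m ≤ R`, `z ≤ 0`: `R^z ≤ m^z`, so
`K R^{2−τ} = K R^{2−τ'} R^{τ'−τ} ≤ (K m^{τ'−τ}) R^{2−τ'}` whenever `τ' ≤ τ` (`Real.rpow` algebra).
[folklore] -/
theorem rpow_pinching_mono {m R K τ τ' : ℝ} (hm : 0 < m) (hmR : m ≤ R) (hK : 0 ≤ K) (hτ' : τ' ≤ τ) :
    K * R ^ (2 - τ) ≤ K * m ^ (τ' - τ) * R ^ (2 - τ') := by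
  have hR : 0 < R := hm.trans_le hmR
  have hsplit : R ^ (2 - τ) = R ^ (2 - τ') * R ^ (τ' - τ) := by
    rw [← Real.rpow_add hR]; ring_nf
  rw [hsplit, mul_assoc, mul_comm (m ^ (τ' - τ))]
  refine mul_le_mul_of_nonneg_left (mul_le_mul_of_nonneg_left ?_ (Real.rpow_nonneg hR.le _)) hK
  exact Real.antitoneOn_rpow_Ioi_of_exponent_nonpos (by linarith) (mem_Ioi.2 hm) (mem_Ioi.2 hR) hmR

/-- **Hamilton's pinching set of `hamilton_convergenceCriterion_four` lies in a `pinchingSet` with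
exponent `≤ 1`**: if the blocks `(A, B, C)` of a Levi-Civita connection in a frame satisfy
`m ≤ tr A + tr C` and `‖A‖² + 2‖B‖² + ‖C‖² − (tr A + tr C)²/6 ≤ K (tr A + tr C)^{2−τ}` (`m, τ > 0`,
`K ≥ 0`), then with `τ' = min τ 1`, `K' = K m^{τ'−τ}`, `c = K' m^{−τ'}` they lie in
`pinchingSet m c K' τ'`: `A`, `C` are symmetric with `tr A = tr C` (`blockA_isSymm`, `blockC_isSymm`,
`trace_blockA_eq_trace_blockC` — any Levi-Civita connection, any frame), `R ≥ m > 0`, and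
`rpow_pinching_mono` twice. [cite: Hamilton1986, §5, Def. 5.1 and 5.2 (pp. 163–164)] -/
theorem mem_pinchingSet_of_hamiltonSet
    {M : Type} [TopologicalSpace M] [ChartedSpace (EuclideanSpace ℝ (Fin 4)) M] [IsManifold (𝓡 4) ∞ M]
    {g : PseudoRiemannianMetric (𝓡 4) ∞ (EuclideanSpace ℝ (Fin 4)) (TangentSpace (𝓡 4) : M → Type _)}
    [g.HasLeviCivita]
    {cov : CovariantDerivative (𝓡 4) (EuclideanSpace ℝ (Fin 4)) (TangentSpace (𝓡 4) : M → Type _)}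
    (hcov : g.IsLeviCivita cov) {m K τ : ℝ} (hm : 0 < m) (hK : 0 ≤ K) (hτ : 0 < τ)
    {x : M} (e : Fin 4 → TangentSpace (𝓡 4) x)
    (hmem : m ≤ (g.blockA cov x e).trace + (g.blockC cov x e).trace ∧
      (∑ i, ∑ j, g.blockA cov x e i j ^ 2) + 2 * (∑ i, ∑ j, g.blockB cov x e i j ^ 2) +
          (∑ i, ∑ j, g.blockC cov x e i j ^ 2) -
          ((g.blockA cov x e).trace + (g.blockC cov x e).trace) ^ 2 / 6 ≤
        K * ((g.blockA cov x e).trace + (g.blockC cov x e).trace) ^ (2 - τ)) :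
    (g.blockA cov x e, g.blockB cov x e, g.blockC cov x e) ∈
      pinchingSet m (K * m ^ (min τ 1 - τ) * m ^ (-min τ 1)) (K * m ^ (min τ 1 - τ)) (min τ 1) := by
  have hn : (2 : ℕ∞ω) ≤ ∞ := WithTop.coe_le_coe.mpr le_top
  obtain ⟨hmR, hdev⟩ := hmem
  set R := (g.blockA cov x e).trace + (g.blockC cov x e).trace with hRdef
  have hR : 0 < R := hm.trans_le hmR
  have hK' : 0 ≤ K * m ^ (min τ 1 - τ) := mul_nonneg hK (Real.rpow_nonneg hm.le _)
  -- the two scale comparisons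
  have h1 : K * R ^ (2 - τ) ≤ K * m ^ (min τ 1 - τ) * R ^ (2 - min τ 1) :=
    rpow_pinching_mono hm hmR hK (min_le_left τ 1)
  have h2 : K * m ^ (min τ 1 - τ) * R ^ (2 - min τ 1) ≤
      K * m ^ (min τ 1 - τ) * m ^ (-min τ 1) * R ^ 2 := by
    have h := rpow_pinching_mono (τ := min τ 1) (τ' := 0) hm hmR hK' (lt_min hτ one_pos).le
    rw [zero_sub, sub_zero, Real.rpow_two] at h
    exact h
  have hscal : scal (g.blockA cov x e, g.blockB cov x e, g.blockC cov x e) = R := rfl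
  have hdev' : devNormSq (g.blockA cov x e, g.blockB cov x e, g.blockC cov x e) =
      (∑ i, ∑ j, g.blockA cov x e i j ^ 2) + 2 * (∑ i, ∑ j, g.blockB cov x e i j ^ 2) +
        (∑ i, ∑ j, g.blockC cov x e i j ^ 2) - R ^ 2 / 6 := rfl
  refine mem_pinchingSet.2 ⟨mem_margerinCone.2 ⟨blockA_isSymm hcov hn x e, blockC_isSymm hcov hn x e,
    trace_blockA_eq_trace_blockC hcov hn x e, ?_, ?_⟩, ?_, ?_⟩
  · rw [hscal]; exact hR.le
  · rw [hscal, hdev']; exact (hdev.trans h1).trans h2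
  · rw [hscal]; exact hmR
  · rw [hscal, hdev']; exact hdev.trans h1

/-! ## Hamilton's convergence criterion from the blow-up limit -/

/-- **Hamilton's convergence criterion 5.2 (the tree's bespoke named fact
`hamilton_convergenceCriterion_four`, Hamilton 1986, §5) FOLLOWS from the blow-up limit
`ricciFlow_blowupLimit_four`** (Topping 2006, Thm. 8.5.1): reduce the exponent to `τ' = min τ 1 ≤ 1`
(`mem_pinchingSet_of_hamiltonSet`) and run the chain `constantCurvature_of_pinchedFlows`. Consequently
the flow stubs of BOTH lines of the crux (this line's p84954, `gv-continuity-path`'s p108727) rest on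
the standard compactness theorem. [cite: Hamilton1986, §5, 5.2 (p. 164)] [cite: Topping2006, §8.5, Thm. 8.5.1] -/
theorem hamilton_convergenceCriterion_four_of_blowupLimit (hbl : ricciFlow_blowupLimit_four) :
    hamilton_convergenceCriterion_four := by
  intro M _ _ _ _ _ _ _ g₀ m K τ hg₀ hm hK hτ hflows
  refine constantCurvature_of_pinchedFlows hbl M g₀ m (K * m ^ (min τ 1 - τ) * m ^ (-min τ 1))
    (K * m ^ (min τ 1 - τ)) (min τ 1) hg₀ hm (mul_pos hK (Real.rpow_pos_of_pos hm _))
    (lt_min hτ one_pos) (min_le_right τ 1) fun T g cov hflow hR h0 t ht x e he ↦ ?_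
  haveI := (g t).hasLeviCivita
  exact mem_pinchingSet_of_hamiltonSet (hflow.isLeviCivita t ht) hm hK.le hτ e
    (hflows T g cov hflow hR h0 t ht x e he)

/-! ## The crux modulo the blow-up limit and the Thm-1.4 leaf -/

open Summit.SmoothPoincare4.SmoothPoincare4.Theses.EntropyRung (ChangGurskyYang)
/-- **The crux `EntropyRung.ChangGurskyYang` from the blow-up limit and CGY Thm. 1.4**: Chern–Gauss–Bonnet
is a theorem of the tree, Margerin's leaf is STUBS 1–3 (landed) + STUB 4 (this file, modulo
`ricciFlow_blowupLimit_four`), Thm. 1.4 stays a named fact (`changGurskyYang_theorem14_four`); composition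
through `ChangGurskyYang_of_theorem14_of_convergenceCriterion` (p96074).
[cite: ChangGurskyYang2003, §2, p. 121] [cite: Topping2006, §8.5, Thm. 8.5.1] -/
theorem ChangGurskyYang_of_blowupLimit_of_theorem14 :
    ricciFlow_blowupLimit_four → changGurskyYang_theorem14_four → ChangGurskyYang :=
  fun hbl h14 ↦ ChangGurskyYang_of_theorem14_of_convergenceCriterion h14
    (hamilton_convergenceCriterion_four_of_blowupLimit hbl)

/-- The same for the item's second route decl `WeylBudget.ChangGurskyYang` (the same proposition).
[cite: ChangGurskyYang2003, Thm. A] -/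
theorem ChangGurskyYang_weylBudget_of_blowupLimit_of_theorem14 :
    ricciFlow_blowupLimit_four → changGurskyYang_theorem14_four →
      Summit.SmoothPoincare4.SmoothPoincare4.Theses.WeylBudget.ChangGurskyYang :=
  ChangGurskyYang_of_blowupLimit_of_theorem14

end Summit.SmoothPoincare4.SmoothPoincare4.Theorems.MargerinRails

end
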